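import Summits.HubbardSuperconductivity.HubbardSuperconductivity.Theorems.AnisotropyChordTransferFibre3L2TCell
import Summits.HubbardSuperconductivity.HubbardSuperconductivity.Theorems.AnisotropyChordTransferFibre3B1EvalRing

/-!
# Route `AnisotropyChord` / H0 rotor rung, LEVEL 2 cell evaluator for the t-BLOCKS: the RING-checked block cell
★ `TCell.checkR` / ★★ `TCell.point_mem_boxR`, and the checker-agnostic admissibility predicate ★ `TCell.Adm`

ASK 3 of the t-block campaign (route lead p1 g32): the all-`L ≥ L₀` brackets of the ten named B1 sums in `L2.TCell.check` use
`B1.cellCheck L₀` (window `K = L₀/4`, Jordan tail `tailConstQ(n, K′ = K − S)` — `0.0747` at `L₀ = 64`, 8× the true lattice tail),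
which makes the block brackets of `θ⁴S₂`, `θ⁴T10`, … about `0.108` wide at `L₀ = 64` (vs `0.041` at `128`) and leaves the high-`ν`
tops of the blocks open.  p1's `…Fibre3B1EvalRing` provides the drop-in ★ `B1.cellCheckR … R` / ★★ `B1.cell_soundR` (ring
`K < |q|∞ ≤ R` evaluated pointwise with `max(Taylor, Jordan)` weights, Jordan tail only beyond `R − S`; same conclusion as
`B1.cell_sound`).  This file is the `L2.TCell` side:
* ★ `TCell.checkR c` — `TCell.check` with the ten `B1.cellCheck c.L₀ …` replaced by `B1.cellCheckR c.L₀ … R`, ring radius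
  `R = c.L₀/2 − 1` for the unshifted sums (`S = 0`: `θ⁴S₂, θ⁶S₃, θ⁸S₄`) and `R = c.L₀/2 − 2` for the shifted ones (`S = 1`:
  `T10, T11, G21, G12, G22, G31, G13`) — the largest radii allowed by `cellCheckR` (`2(R + S) < L₀`, `L₀/2 + R < L₀`); the t-slot
  scale checks and the two `B1.txCellCheckG c.L₀` certificates are unchanged;
* ★★ `TCell.point_mem_boxR` — the box bridge with the SAME conclusion as `TCell.point_mem_box` (proof verbatim with `cell_soundR`);
* ★ `TCell.Adm c : Prop` — the CHECKER-AGNOSTIC admissibility of a block cell: exactly the conclusion of `point_mem_box`, universally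
  quantified (every `L` of the block, every `ν` in the cell, every `a ∈ [a₁, a₂]` ⟹ `point L λ₂ a ∈ c.box a₁ a₂`);
  `TCell.adm_of_check` and `TCell.adm_of_checkR` feed it from either kernel certificate.  Downstream block theorems stated with
  `(hc : c.Adm)` (the `…TA` twins of the N₁ chain, the side cells, rows C/D) therefore serve the present cells (`adm_of_check`), the
  ring-sharpened cells (`adm_of_checkR`) and any future sharper checker without further twins.
Prover seat `hubbard-h0-rotor-p2` g8; helper for piece A = stmt-HubbardSuperconductivity-23918 of rung 19089 (`--supports`, helper
class).  Nothing here proves superconductivity in the Hubbard model; an evaluator bridge of ONE conditional reduction (the GM₃ ∀L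
certificate, Level-2 rows on t-blocks).  Mathlib + the tree only; no sorry.
-/

set_option linter.dupNamespace false
set_option autoImplicit false

open scoped BigOperators
open Literature.Analysis.ValidatedNumerics

namespace Summit.HubbardSuperconductivity.HubbardSuperconductivity.Theorems.AnisotropyChord.Transfer.Fibre3.L2

/-! ## The ring check -/

/-- ★ the RING block checks: scales of the t-slot, ten `B1.cellCheckR c.L₀ … R` (`R = L₀/2 − 1` unshifted, `L₀/2 − 2`
shifted sums) and the two `B1.txCellCheckG c.L₀` certificates (unchanged). -/
def TCell.checkR (c : TCell) : Bool :=
  decide (0 < c.L0) && decide ((2 * B1.piHi / c.L0) ^ 2 ≤ c.thi) &&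
  (decide (c.tlo ≤ 0) || (decide (0 < c.L1) && decide (c.tlo * (c.L1 : ℚ) ^ 2 ≤ 4 * Hole2.piLo ^ 2))) &&
  B1.cellCheckR c.L0 c.n1 c.n2 c.νd c.Tn c.Td 0 ![((0 : ℤ), (0 : ℤ))] ![2] 2 c.D c.bS2.1 c.bS2.2 (c.L0 / 2 - 1) &&
  B1.cellCheckR c.L0 c.n1 c.n2 c.νd c.Tn c.Td 0 ![((0 : ℤ), (0 : ℤ))] ![3] 3 c.D c.bS3.1 c.bS3.2 (c.L0 / 2 - 1) &&
  B1.cellCheckR c.L0 c.n1 c.n2 c.νd c.Tn c.Td 0 ![((0 : ℤ), (0 : ℤ))] ![4] 4 c.D c.bS4.1 c.bS4.2 (c.L0 / 2 - 1) &&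
  B1.cellCheckR c.L0 c.n1 c.n2 c.νd c.Tn c.Td 1 ![((0 : ℤ), (0 : ℤ)), (1, 0)] ![1, 1] 2 c.D c.bT10.1 c.bT10.2 (c.L0 / 2 - 2) &&
  B1.cellCheckR c.L0 c.n1 c.n2 c.νd c.Tn c.Td 1 ![((0 : ℤ), (0 : ℤ)), (1, 1)] ![1, 1] 2 c.D c.bT11.1 c.bT11.2 (c.L0 / 2 - 2) &&
  B1.cellCheckR c.L0 c.n1 c.n2 c.νd c.Tn c.Td 1 ![((0 : ℤ), (0 : ℤ)), (1, 0)] ![2, 1] 3 c.D c.bG21.1 c.bG21.2 (c.L0 / 2 - 2) &&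
  B1.cellCheckR c.L0 c.n1 c.n2 c.νd c.Tn c.Td 1 ![((0 : ℤ), (0 : ℤ)), (1, 0)] ![1, 2] 3 c.D c.bG12.1 c.bG12.2 (c.L0 / 2 - 2) &&
  B1.cellCheckR c.L0 c.n1 c.n2 c.νd c.Tn c.Td 1 ![((0 : ℤ), (0 : ℤ)), (1, 0)] ![2, 2] 4 c.D c.bG22.1 c.bG22.2 (c.L0 / 2 - 2) &&
  B1.cellCheckR c.L0 c.n1 c.n2 c.νd c.Tn c.Td 1 ![((0 : ℤ), (0 : ℤ)), (1, 0)] ![3, 1] 4 c.D c.bG31.1 c.bG31.2 (c.L0 / 2 - 2) &&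
  B1.cellCheckR c.L0 c.n1 c.n2 c.νd c.Tn c.Td 1 ![((0 : ℤ), (0 : ℤ)), (1, 0)] ![1, 3] 4 c.D c.bG13.1 c.bG13.2 (c.L0 / 2 - 2) &&
  B1.txCellCheckG c.L0 c.n1 c.n2 c.νd c.Tn c.Td ((1 : ℤ), (0 : ℤ)) c.D c.bTx10.1 c.bTx10.2 &&
  B1.txCellCheckG c.L0 c.n1 c.n2 c.νd c.Tn c.Td ((1 : ℤ), (1 : ℤ)) c.D c.bTx11.1 c.bTx11.2


/-! ## The checker-agnostic admissibility predicate -/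

/-- ★ ADMISSIBILITY of a block cell (checker-agnostic): for every `L` of the block (`c.L₀ ≤ L`, and `L ≤ c.L₁` unless `c.L₁ = 0`),
every `λ₂` with `ν = λ₂/θ²` in the cell and every `a ∈ [a₁, a₂]`, the true sixteen-variable vector lies in the cell's box —
exactly the conclusion of `TCell.point_mem_box` / `point_mem_boxR`. -/
def TCell.Adm (c : TCell) : Prop :=
  ∀ (a1 a2 : ℚ) (L : ℕ) [NeZero L], c.L0 ≤ L → (c.L1 = 0 ∨ L ≤ c.L1) → ∀ (lam2 a : ℝ),
    (c.n1 : ℝ) / c.νd ≤ lam2 / (2 * Real.pi / L) ^ 2 → lam2 / (2 * Real.pi / L) ^ 2 ≤ (c.n2 : ℝ) / c.νd →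
    ((a1 : ℚ) : ℝ) ≤ a → a ≤ ((a2 : ℚ) : ℝ) → (c.box a1 a2).mem (point L lam2 a)

/-! ## The ring bridge -/

noncomputable section

/-- ★★ **THE RING BLOCK BOX BRIDGE**: a ring-checked block cell's box contains the true variable vector for every `L` of the block
(`c.L₀ ≤ L`, and `L ≤ c.L₁` unless `c.L₁ = 0`), every `λ₂` with `ν = λ₂/θ²` in the cell and every `a ∈ [a₁, a₂]`. -/
theorem TCell.point_mem_boxR (c : TCell) (hc : c.checkR = true) (a1 a2 : ℚ) (L : ℕ) [NeZero L] (hL : c.L0 ≤ L)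
    (hL1 : c.L1 = 0 ∨ L ≤ c.L1) (lam2 a : ℝ)
    (hν1 : (c.n1 : ℝ) / c.νd ≤ lam2 / (2 * Real.pi / L) ^ 2) (hν2 : lam2 / (2 * Real.pi / L) ^ 2 ≤ (c.n2 : ℝ) / c.νd)
    (ha1 : ((a1 : ℚ) : ℝ) ≤ a) (ha2 : a ≤ ((a2 : ℚ) : ℝ)) :
    (c.box a1 a2).mem (point L lam2 a) := by
  unfold TCell.checkR at hc
  simp only [Bool.and_eq_true, Bool.or_eq_true, decide_eq_true_eq] at hc
  obtain ⟨⟨⟨⟨⟨⟨⟨⟨⟨⟨⟨⟨⟨⟨hL0p, hthi⟩, htlo⟩, hS2⟩, hS3⟩, hS4⟩, hT10⟩, hT11⟩, hG21⟩, hG12⟩, hG22⟩, hG31⟩, hG13⟩, hTx10⟩,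
    hTx11⟩ := hc
  have hLpos : (0 : ℝ) < L := by exact_mod_cast (show 0 < L by omega)
  have hθpos : (0 : ℝ) < 2 * Real.pi / L := by positivity
  have hθ2 : (2 * Real.pi / L) ^ 2 ≠ 0 := by positivity
  set ν : ℝ := lam2 / (2 * Real.pi / L) ^ 2 with hνdef
  have hlam : lam2 = ν * (2 * Real.pi / L) ^ 2 := by rw [hνdef, div_mul_cancel₀ _ hθ2]
  have eS2 := B1.cell_soundR c.L0 c.n1 c.n2 c.νd c.Tn c.Td 0 _ _ 2 c.D _ _ _ hS2 L hL ν hν1 hν2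
  have eS3 := B1.cell_soundR c.L0 c.n1 c.n2 c.νd c.Tn c.Td 0 _ _ 3 c.D _ _ _ hS3 L hL ν hν1 hν2
  have eS4 := B1.cell_soundR c.L0 c.n1 c.n2 c.νd c.Tn c.Td 0 _ _ 4 c.D _ _ _ hS4 L hL ν hν1 hν2
  have eT10 := B1.cell_soundR c.L0 c.n1 c.n2 c.νd c.Tn c.Td 1 _ _ 2 c.D _ _ _ hT10 L hL ν hν1 hν2
  have eT11 := B1.cell_soundR c.L0 c.n1 c.n2 c.νd c.Tn c.Td 1 _ _ 2 c.D _ _ _ hT11 L hL ν hν1 hν2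
  have eG21 := B1.cell_soundR c.L0 c.n1 c.n2 c.νd c.Tn c.Td 1 _ _ 3 c.D _ _ _ hG21 L hL ν hν1 hν2
  have eG12 := B1.cell_soundR c.L0 c.n1 c.n2 c.νd c.Tn c.Td 1 _ _ 3 c.D _ _ _ hG12 L hL ν hν1 hν2
  have eG22 := B1.cell_soundR c.L0 c.n1 c.n2 c.νd c.Tn c.Td 1 _ _ 4 c.D _ _ _ hG22 L hL ν hν1 hν2
  have eG31 := B1.cell_soundR c.L0 c.n1 c.n2 c.νd c.Tn c.Td 1 _ _ 4 c.D _ _ _ hG31 L hL ν hν1 hν2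
  have eG13 := B1.cell_soundR c.L0 c.n1 c.n2 c.νd c.Tn c.Td 1 _ _ 4 c.D _ _ _ hG13 L hL ν hν1 hν2
  have eTx10 := B1.tx_cell_soundG c.L0 c.n1 c.n2 c.νd c.Tn c.Td _ c.D _ _ hTx10 L hL ν hν1 hν2
  have eTx11 := B1.tx_cell_soundG c.L0 c.n1 c.n2 c.νd c.Tn c.Td _ c.D _ _ hTx11 L hL ν hν1 hν2
  rw [← hlam] at eS2 eS3 eS4 eT10 eT11 eG21 eG12 eG22 eG31 eG13 eTx10 eTx11
  have hθbox := c.theta_sq_mem hL0p hthi htlo L hL hL1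
  have hπ := pi_sq_mem
  intro i
  unfold TCell.box Box.ivl
  match i with
  | 0 => simpa [point] using hθbox
  | 1 => simpa [point, pi2Box] using hπ
  | 2 => simpa [point] using ⟨hν1, hν2⟩
  | 3 => simpa [point] using ⟨ha1, ha2⟩
  | 4 => simpa [point, S2n] using eS2
  | 5 => simpa [point, S3n] using eS3
  | 6 => simpa [point, S4n] using eS4
  | 7 => simpa [point, T10n] using eT10
  | 8 => simpa [point, T11n] using eT11
  | 9 => simpa [point, G21n] using eG21
  | 10 => simpa [point, G12n] using eG12
  | 11 => simpa [point, G22n] using eG22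
  | 12 => simpa [point, G31n] using eG31
  | 13 => simpa [point, G13n] using eG13
  | 14 => simpa [point] using eTx10
  | 15 => simpa [point] using eTx11
  | n + 16 => simp [point]


/-- a `check`ed block cell (window/Jordan certificates, `B1.cellCheck c.L₀`) is admissible. -/
theorem TCell.adm_of_check (c : TCell) (hc : c.check = true) : c.Adm := by
  intro a1 a2 L _ hL hL1 lam2 a hν1 hν2 ha1 ha2; exact c.point_mem_box hc a1 a2 L hL hL1 lam2 a hν1 hν2 ha1 ha2

/-- a RING-`checkR`ed block cell (`B1.cellCheckR c.L₀ … R`) is admissible. -/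
theorem TCell.adm_of_checkR (c : TCell) (hc : c.checkR = true) : c.Adm := by
  intro a1 a2 L _ hL hL1 lam2 a hν1 hν2 ha1 ha2; exact c.point_mem_boxR hc a1 a2 L hL hL1 lam2 a hν1 hν2 ha1 ha2

/-- the membership an admissible cell provides (the shape of `point_mem_box`, for use in the `…TA` twins). -/
theorem TCell.Adm.mem {c : TCell} (hc : c.Adm) (a1 a2 : ℚ) (L : ℕ) [NeZero L] (hL : c.L0 ≤ L)
    (hL1 : c.L1 = 0 ∨ L ≤ c.L1) (lam2 a : ℝ)
    (hν1 : (c.n1 : ℝ) / c.νd ≤ lam2 / (2 * Real.pi / L) ^ 2) (hν2 : lam2 / (2 * Real.pi / L) ^ 2 ≤ (c.n2 : ℝ) / c.νd)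
    (ha1 : ((a1 : ℚ) : ℝ) ≤ a) (ha2 : a ≤ ((a2 : ℚ) : ℝ)) :
    (c.box a1 a2).mem (point L lam2 a) :=
  hc a1 a2 L hL hL1 lam2 a hν1 hν2 ha1 ha2

end

end Summit.HubbardSuperconductivity.HubbardSuperconductivity.Theorems.AnisotropyChord.Transfer.Fibre3.L2
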